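import Literature.Barriers.CriticalPhenomena.LongRangeTrivialityOnZ3TwoPoint

/-!
# Left-continuity in `β` of the free long-range Ising state, and Theorem 3.18 at `β_c` from
# Theorem 3.18 below `β_c`

Sibling of `Literature/Barriers/CriticalPhenomena/LongRangeTrivialityOnZ3TwoPoint.lean` (barrier
catalogue D-0021, sub-problem `Ising3DConformalLimit`), first (elementary) layer under the named fact
`panis_slidingScale_infraredBound` (Panis 2023, arXiv:2309.05797, Theorem 3.18 = Aizenman–Duminil-Copin
2021, Theorem 5.6, extended to reflection-positive long-range couplings). The printed proof of
Theorem 5.6 begins: "it suffices to prove the claim for all `β < β_c(ρ)`, with a uniform constant `C`.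
Its extension to the critical point can be deduced from the continuity `S_{ρ,β_c}(x) = lim S_{ρ,β}(x)`
(which follows from the main result of [AizDumSid15])". For the state used by the barrier files — the
free-boundary infinite-volume state `LongRangeIsing.state J β 0` along boxes — this continuity from
the left is elementary and is PROVED here for every ferromagnetic pair interaction `J ≥ 0`:

* `expectIn_spinProduct_mono_beta`, `continuous_expectIn_beta`: finite-volume correlations are
  nondecreasing (Griffiths' comparison of couplings, `gksExpect_mono_of_abs_le`) and continuous in `β`;
* `state_spinProduct_mono_beta`: so is their box limit `⟨σ_A⟩_{J,0,β}` nondecreasing in `β ≥ 0`;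
* `tendsto_state_spinProduct_nhdsLT` (and `tendsto_pairCorrelation_nhdsLT`,
  `tendsto_boxSusceptibility_nhdsLT`): an increasing limit of continuous nondecreasing functions is
  nondecreasing and lower semicontinuous, hence continuous from the left at every `β₀ > 0`;
* `panis_slidingScale_infraredBound_of_subcritical`: the vendored Theorem 3.18 (`0 < β ≤ β_c`) follows
  from the same inequality for `0 < β < β_c` with the same constant, by letting `β ↑ β_c` on both sides.

The subcritical inequality itself is NOT proved here (see `LongRangeTrivialityOnZ3NoSlidingScale.lean`
for why the printed route does not cover the couplings `C₀|x-y|₁^{-d-α}`, and for the barrier without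
Theorem 3.18).

## References

* M. Aizenman, H. Duminil-Copin, Ann. Math. 194 (2021), proof of Theorem 5.6, first paragraph
  [AizenmanDuminilCopinAnnals2021] (held, read p. 18).
* R. Panis, arXiv:2309.05797 (2023) = Ann. Probab. 54 (2026), Theorem 3.18 [Panis2023Triviality].
* S. Friedli, Y. Velenik, *Statistical Mechanics of Lattice Systems*, CUP (2017), Exercise 3.31
  (comparison of coupling constants) [FriedliVelenik2017].
-/

noncomputable section

namespace Literature.Barriers.CriticalPhenomena

open Literature.Probability.LatticeModels Literature.Probability.Percolation Filter Topology Finset Set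
open scoped symmDiff

namespace LongRangeIsing

variable {d : ℕ}

/-! ### Monotonicity and continuity in `β` of the finite-volume correlations -/

section FiniteVolumeBeta

variable (J : Site d → Site d → ℝ) (Λ : Finset (Site d))

/-- **Griffiths II in the inverse temperature**: `⟨σ_A⟩_{Λ,J,0,β} ≤ ⟨σ_A⟩_{Λ,J,0,β'}` for
`0 ≤ β ≤ β'` and `J ≥ 0` (comparison of the couplings `(β/2)J ≤ (β'/2)J`).
[cite: FriedliVelenik2017, Exercise 3.31, p. 142] -/
theorem expectIn_spinProduct_mono_beta (hJ : ∀ x y, 0 ≤ J x y) {β β' : ℝ} (hβ : 0 ≤ β) (hββ' : β ≤ β')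
    (A : Finset (Site d)) :
    expectIn J Λ β 0 (spinProduct A) ≤ expectIn J Λ β' 0 (spinProduct A) := by
  rw [expectIn_spinProduct_eq_gksExpect, expectIn_spinProduct_eq_gksExpect]
  refine gksExpect_mono_of_abs_le _ _ (fun p _ => ?_) _
  rw [abs_of_nonneg (mul_nonneg (by positivity) (hJ _ _))]
  exact mul_le_mul_of_nonneg_right (by linarith) (hJ _ _)

/-- The finite-volume expectation `⟨F⟩_{Λ,J,h,β}` is continuous in `β` (a ratio of finite sums of
exponentials with positive denominator). [folklore] -/
theorem continuous_expectIn_beta (h : ℝ) (F : SpinConfig (Site d) → ℝ) :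
    Continuous fun β => expectIn J Λ β h F := by
  unfold expectIn pairGibbsWeight
  refine Continuous.div (continuous_finsetSum _ fun τ _ => ?_) (continuous_finsetSum _ fun τ _ => ?_)
    fun β => (partitionSum_pos J Λ β h).ne'
  · fun_prop
  · fun_prop

end FiniteVolumeBeta

/-! ### Monotonicity and left-continuity in `β` of the infinite-volume state -/

section StateBeta

variable (J : Site d → Site d → ℝ)

/-- **`⟨σ_A⟩_{J,0,β}` is nondecreasing in `β ≥ 0`** (`J ≥ 0`): the box limit of `expectIn_spinProduct_mono_beta`.
[cite: FriedliVelenik2017, Exercise 3.31, p. 142] -/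
theorem state_spinProduct_mono_beta (hJ : ∀ x y, 0 ≤ J x y) {β β' : ℝ} (hβ : 0 ≤ β) (hββ' : β ≤ β')
    (A : Finset (Site d)) :
    state J β 0 (spinProduct A) ≤ state J β' 0 (spinProduct A) :=
  le_of_tendsto_of_tendsto (tendsto_expectIn_box J β hβ hJ A) (tendsto_expectIn_box J β' (hβ.trans hββ') hJ A)
    (Eventually.of_forall fun L => expectIn_spinProduct_mono_beta J (box d L) hJ hβ hββ' A)

/-- **Left-continuity of `β ↦ ⟨σ_A⟩_{J,0,β}` on `(0,∞)`** for `J ≥ 0`: the state is the increasing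
limit (in the volume) of finite-volume correlations, each continuous and nondecreasing in `β`, hence
it is nondecreasing and lower semicontinuous in `β`, hence continuous from the left. (For the free
state this replaces the appeal to the continuity results of Aizenman–Duminil-Copin–Sidoravicius 2015
in the first step of the proof of Theorem 5.6 of Aizenman–Duminil-Copin 2021.)
[cite: AizenmanDuminilCopinAnnals2021, proof of Theorem 5.6, first paragraph] -/
theorem tendsto_state_spinProduct_nhdsLT (hJ : ∀ x y, 0 ≤ J x y) {β₀ : ℝ} (hβ₀ : 0 < β₀)
    (A : Finset (Site d)) :
    Tendsto (fun β => state J β 0 (spinProduct A)) (𝓝[<] β₀) (𝓝 (state J β₀ 0 (spinProduct A))) := by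
  have hpos : ∀ᶠ β in 𝓝[<] β₀, 0 < β ∧ β < β₀ := by
    filter_upwards [Ioo_mem_nhdsLT hβ₀] with β hβ
    exact hβ
  rw [tendsto_order]
  constructor
  · intro a ha
    obtain ⟨L₀, hL₀⟩ := exists_forall_subset_box d A
    have hlim := tendsto_expectIn_box J β₀ hβ₀.le hJ A
    obtain ⟨L, hL, haL⟩ : ∃ L, L₀ ≤ L ∧ a < expectIn J (box d L) β₀ 0 (spinProduct A) :=
      ((eventually_ge_atTop L₀).and (hlim.eventually (lt_mem_nhds ha))).exists
    have hcont : ∀ᶠ β in 𝓝 β₀, a < expectIn J (box d L) β 0 (spinProduct A) :=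
      (continuous_expectIn_beta J (box d L) 0 (spinProduct A)).continuousAt.eventually (lt_mem_nhds haL)
    filter_upwards [nhdsWithin_le_nhds hcont, hpos] with β hβ1 hβ2
    exact hβ1.trans_le (expectIn_le_state J β hβ2.1.le hJ (hL₀ L hL))
  · intro b hb
    filter_upwards [hpos] with β hβ
    exact (state_spinProduct_mono_beta J hJ hβ.1.le hβ.2.le A).trans_lt hb

/-- Left-continuity of the two-point function `β ↦ ⟨σ_xσ_y⟩_{J,0,β}` at every `β₀ > 0` (`J ≥ 0`).
[cite: AizenmanDuminilCopinAnnals2021, proof of Theorem 5.6, first paragraph] -/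
theorem tendsto_pairCorrelation_nhdsLT (hJ : ∀ x y, 0 ≤ J x y) {β₀ : ℝ} (hβ₀ : 0 < β₀) (x y : Site d) :
    Tendsto (fun β => pairCorrelation J β x y) (𝓝[<] β₀) (𝓝 (pairCorrelation J β₀ x y)) := by
  simp_rw [pairCorrelation_eq]
  exact tendsto_state_spinProduct_nhdsLT J hJ hβ₀ _

/-- Left-continuity of `β ↦ χ_L(β)` at every `β₀ > 0` (`J ≥ 0`). [folklore] -/
theorem tendsto_boxSusceptibility_nhdsLT (hJ : ∀ x y, 0 ≤ J x y) {β₀ : ℝ} (hβ₀ : 0 < β₀) (L : ℕ) :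
    Tendsto (fun β => boxSusceptibility J β L) (𝓝[<] β₀) (𝓝 (boxSusceptibility J β₀ L)) :=
  tendsto_finsetSum _ fun x _ => tendsto_pairCorrelation_nhdsLT J hJ hβ₀ 0 x

end StateBeta

end LongRangeIsing

open LongRangeIsing

/-! ### Theorem 3.18 at `β = β_c` from Theorem 3.18 for `β < β_c` -/

/-- **The sliding-scale infrared bound extends from `β < β_c` to `β ≤ β_c`** ("it suffices to prove
the claim for all `β < β_c(ρ)`, with a uniform constant `C`. Its extension to the critical point can be
deduced from the continuity `S_{ρ,β_c}(x) = lim_{β→β_c} S_{ρ,β}(x)`", first step of the proof of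
Theorem 5.6 of Aizenman–Duminil-Copin 2021, the proof Panis's Theorem 3.18 refers to): for the free
state used here the left-continuity is `tendsto_boxSusceptibility_nhdsLT`, and both sides of the
inequality pass to the limit `β ↑ β_c`. [cite: AizenmanDuminilCopinAnnals2021, proof of Theorem 5.6, first paragraph] -/
theorem panis_slidingScale_infraredBound_of_subcritical
    (h : ∀ (d : ℕ), 2 ≤ d → ∀ (C₀ α : ℝ), 0 < C₀ → 0 < α →
      ∃ C : ℝ, 0 < C ∧ ∀ (β : ℝ), 0 < β → β < LongRangeIsing.criticalBeta (algebraicCoupling d C₀ α) →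
        ∀ (ℓ L : ℕ), 1 ≤ ℓ → ℓ ≤ L →
          boxSusceptibility (algebraicCoupling d C₀ α) β L / (L : ℝ) ^ 2 ≤
            C / β * (boxSusceptibility (algebraicCoupling d C₀ α) β ℓ / (ℓ : ℝ) ^ 2)) :
    panis_slidingScale_infraredBound := by
  intro d hd C₀ α hC₀ hα
  set J := algebraicCoupling d C₀ α with hJdef
  have hJ0 : ∀ x y, 0 ≤ J x y := algebraicCoupling_nonneg hC₀.le α
  obtain ⟨C, hC, hsub⟩ := h d hd C₀ α hC₀ hα
  refine ⟨C, hC, fun β hβ hβc ℓ L hℓ hℓL => ?_⟩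
  rcases hβc.lt_or_eq with hlt | heq
  · exact hsub β hβ hlt ℓ L hℓ hℓL
  · have key : ∀ᶠ β' in 𝓝[<] β, boxSusceptibility J β' L / (L : ℝ) ^ 2 ≤
        C / β' * (boxSusceptibility J β' ℓ / (ℓ : ℝ) ^ 2) := by
      filter_upwards [Ioo_mem_nhdsLT hβ] with β' hβ'
      exact hsub β' hβ'.1 (heq ▸ hβ'.2) ℓ L hℓ hℓL
    have hlhs : Tendsto (fun β' => boxSusceptibility J β' L / (L : ℝ) ^ 2) (𝓝[<] β)
        (𝓝 (boxSusceptibility J β L / (L : ℝ) ^ 2)) :=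
      (tendsto_boxSusceptibility_nhdsLT J hJ0 hβ L).div_const _
    have hid : Tendsto (fun β' : ℝ => β') (𝓝[<] β) (𝓝 β) := tendsto_id.mono_left nhdsWithin_le_nhds
    have hrhs : Tendsto (fun β' => C / β' * (boxSusceptibility J β' ℓ / (ℓ : ℝ) ^ 2)) (𝓝[<] β)
        (𝓝 (C / β * (boxSusceptibility J β ℓ / (ℓ : ℝ) ^ 2))) :=
      (tendsto_const_nhds.div hid hβ.ne').mul ((tendsto_boxSusceptibility_nhdsLT J hJ0 hβ ℓ).div_const _)
    exact le_of_tendsto_of_tendsto hlhs hrhs key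

end Literature.Barriers.CriticalPhenomena

end
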